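import Summits.KontsevichZagierPeriods.KontsevichZagierPeriods.Theorems.SoloInformedToricMonoChart
import HarnessLib

/-!
# The two triangle charts of the square and THEOREM DIAG

Solo programme `solo-KontsevichZagierPeriods-informed`, session s105 (toolkit for the first
cube-DEGENERATE denominators, THEOREM CUSP in `SoloInformedToricCuspCharts`).

The monomial charts `μ_low (v) = (v₀, v₀v₁)` (exponent matrix `!![1, 0; 1, 1]`) and
`μ_up (u) = (u₀u₁, u₁)` (`!![1, 1; 0, 1]`) map the open square onto the open triangles
`{0 < y < x < 1}` and `{0 < x < y < 1}` with Jacobians `v₀` and `u₁`; the square is the union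
of the two triangles up to the null set `∂[0,1]² ∪ {x = y}`.  Hence

* **THEOREM DIAG** `soloInformed_presentable_of_diagonalCharts`: `[σ, P/Q]`
  (`(0,1)² ⊆ σ ⊆ [0,1]²`) is presentable (`k = 1` in the cube crux
  `SoloInformedAyoubCubeResolutionCube`) as soon as the two pulled-back forms
  `f(v₀, v₀v₁) v₀ = P₁/Q₁` and `f(u₀u₁, u₁) u₁ = P₂/Q₂` fall under a presentability criterion
  on `(0,1)²`;
* `soloInformed_presentable_of_diagonalCharts_vertex`: in particular as soon as some vertex
  reflection of each `Qᵢ` is cube-nondegenerate (THEOREM VERTEX).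

This is the blow-up of the origin read in its two affine charts and restricted to the unit
square — the first step of a calculus-internal resolution algorithm for plane denominators
whose initial forms vanish inside the square.

References: M. Kontsevich, D. Zagier, *Periods* (2001) §1.2 rules (1), (2); W. Fulton,
*Introduction to Toric Varieties* (1993) §2.6; A. N. Varchenko, Funct. Anal. Appl. 10 (1976)
(Newton polyhedra and toric resolutions).
-/

noncomputable section

open scoped BigOperators
open MeasureTheory Set
open Literature.NumberTheory.Transcendental Literature.NumberTheory.Transcendental.KZ
open Literature.ModelTheory.ExponentialFields (IsSemialgebraic)

namespace Summit.KontsevichZagierPeriods.KontsevichZagierPeriods.Theorems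

/-! ## The two triangle charts of the square -/

/-- Exponent matrix of the lower chart `μ_low (v) = (v₀, v₀ v₁)`. -/
def soloInformedLowerMat : Matrix (Fin 2) (Fin 2) ℕ := !![1, 0; 1, 1]

/-- Exponent matrix of the upper chart `μ_up (u) = (u₀ u₁, u₁)`. -/
def soloInformedUpperMat : Matrix (Fin 2) (Fin 2) ℕ := !![1, 1; 0, 1]

/-- The open lower triangle `{0 < y < x < 1}`. -/
def soloInformedLowerTri : Set (Fin 2 → ℝ) := {p | 0 < p 1 ∧ p 1 < p 0 ∧ p 0 < 1}

/-- The open upper triangle `{0 < x < y < 1}`. -/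
def soloInformedUpperTri : Set (Fin 2 → ℝ) := {p | 0 < p 0 ∧ p 0 < p 1 ∧ p 1 < 1}

/-- First component of the lower chart. -/
@[simp] theorem soloInformed_prod_lowerMat_zero (v : Fin 2 → ℝ) :
    (∏ j, v j ^ soloInformedLowerMat 0 j) = v 0 := by
  simp [soloInformedLowerMat, Fin.prod_univ_two]

/-- Second component of the lower chart. -/
@[simp] theorem soloInformed_prod_lowerMat_one (v : Fin 2 → ℝ) :
    (∏ j, v j ^ soloInformedLowerMat 1 j) = v 0 * v 1 := by
  simp [soloInformedLowerMat, Fin.prod_univ_two]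

/-- First component of the upper chart. -/
@[simp] theorem soloInformed_prod_upperMat_zero (v : Fin 2 → ℝ) :
    (∏ j, v j ^ soloInformedUpperMat 0 j) = v 0 * v 1 := by
  simp [soloInformedUpperMat, Fin.prod_univ_two]

/-- Second component of the upper chart. -/
@[simp] theorem soloInformed_prod_upperMat_one (v : Fin 2 → ℝ) :
    (∏ j, v j ^ soloInformedUpperMat 1 j) = v 1 := by
  simp [soloInformedUpperMat, Fin.prod_univ_two]

/-- The lower chart as a vector. -/
theorem soloInformed_lowerChart_eq (v : Fin 2 → ℝ) :
    (fun i => ∏ j, v j ^ soloInformedLowerMat i j) = ![v 0, v 0 * v 1] := by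
  funext i
  fin_cases i
  · exact soloInformed_prod_lowerMat_zero v
  · exact soloInformed_prod_lowerMat_one v

/-- The upper chart as a vector. -/
theorem soloInformed_upperChart_eq (v : Fin 2 → ℝ) :
    (fun i => ∏ j, v j ^ soloInformedUpperMat i j) = ![v 0 * v 1, v 1] := by
  funext i
  fin_cases i
  · exact soloInformed_prod_upperMat_zero v
  · exact soloInformed_prod_upperMat_one v

/-- `det μ_low = 1`. -/
theorem soloInformed_det_lowerMat :
    (soloInformedLowerMat.map (fun t : ℕ => (t : ℝ))).det = 1 := by
  rw [Matrix.det_fin_two]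
  simp [soloInformedLowerMat]

/-- `det μ_up = 1`. -/
theorem soloInformed_det_upperMat :
    (soloInformedUpperMat.map (fun t : ℕ => (t : ℝ))).det = 1 := by
  rw [Matrix.det_fin_two]
  simp [soloInformedUpperMat]

/-- Jacobian of the lower chart: `|det Dμ_low (v)| = v₀` on the positive orthant. [this work] -/
theorem soloInformed_abs_det_monoD_lowerMat {v : Fin 2 → ℝ} (hv : ∀ j, 0 < v j) :
    |(soloInformedMonoD soloInformedLowerMat v).det| = v 0 := by
  rw [soloInformed_abs_det_monoD _ hv, soloInformed_det_lowerMat]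
  simp only [Fin.sum_univ_two, Fin.prod_univ_two, soloInformedLowerMat, Matrix.of_apply,
    Matrix.cons_val', Matrix.cons_val_zero, Matrix.cons_val_one, Matrix.empty_val',
    Matrix.cons_val_fin_one, abs_one, one_mul]
  have h0 := (hv 0).ne'
  have h1 := (hv 1).ne'
  field_simp
  ring

/-- Jacobian of the upper chart: `|det Dμ_up (u)| = u₁` on the positive orthant. [this work] -/
theorem soloInformed_abs_det_monoD_upperMat {v : Fin 2 → ℝ} (hv : ∀ j, 0 < v j) :
    |(soloInformedMonoD soloInformedUpperMat v).det| = v 1 := by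
  rw [soloInformed_abs_det_monoD _ hv, soloInformed_det_upperMat]
  simp only [Fin.sum_univ_two, Fin.prod_univ_two, soloInformedUpperMat, Matrix.of_apply,
    Matrix.cons_val', Matrix.cons_val_zero, Matrix.cons_val_one, Matrix.empty_val',
    Matrix.cons_val_fin_one, abs_one, one_mul]
  have h0 := (hv 0).ne'
  have h1 := (hv 1).ne'
  field_simp
  ring

/-- The lower chart maps the open square onto the lower triangle. [this work] -/
theorem soloInformed_image_lowerChart :
    (fun (v : Fin 2 → ℝ) (i : Fin 2) => ∏ j, v j ^ soloInformedLowerMat i j) ''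
      soloInformedOpenCube 2 = soloInformedLowerTri := by
  ext p
  constructor
  · rintro ⟨v, hv, rfl⟩
    have h0 := hv 0
    have h1 := hv 1
    refine ⟨?_, ?_, ?_⟩ <;> dsimp only
    · rw [soloInformed_prod_lowerMat_one]; exact mul_pos h0.1 h1.1
    · rw [soloInformed_prod_lowerMat_one, soloInformed_prod_lowerMat_zero]
      exact mul_lt_of_lt_one_right h0.1 h1.2
    · rw [soloInformed_prod_lowerMat_zero]; exact h0.2
  · rintro ⟨h1, h2, h3⟩
    have h0 : 0 < p 0 := h1.trans h2
    refine ⟨![p 0, p 1 / p 0], fun j => ?_, ?_⟩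
    · fin_cases j
      · exact ⟨h0, h3⟩
      · exact ⟨div_pos h1 h0, (div_lt_one h0).2 h2⟩
    · funext i
      fin_cases i
      · simp [soloInformedLowerMat, Fin.prod_univ_two]
      · have h0' := h0.ne'
        simp [soloInformedLowerMat, Fin.prod_univ_two]
        field_simp

/-- The upper chart maps the open square onto the upper triangle. [this work] -/
theorem soloInformed_image_upperChart :
    (fun (v : Fin 2 → ℝ) (i : Fin 2) => ∏ j, v j ^ soloInformedUpperMat i j) ''
      soloInformedOpenCube 2 = soloInformedUpperTri := by
  ext p
  constructor
  · rintro ⟨v, hv, rfl⟩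
    have h0 := hv 0
    have h1 := hv 1
    refine ⟨?_, ?_, ?_⟩ <;> dsimp only
    · rw [soloInformed_prod_upperMat_zero]; exact mul_pos h0.1 h1.1
    · rw [soloInformed_prod_upperMat_zero, soloInformed_prod_upperMat_one]
      exact mul_lt_of_lt_one_left h1.1 h0.2
    · rw [soloInformed_prod_upperMat_one]; exact h1.2
  · rintro ⟨h1, h2, h3⟩
    have h0 : 0 < p 1 := h1.trans h2
    refine ⟨![p 0 / p 1, p 1], fun j => ?_, ?_⟩
    · fin_cases j
      · exact ⟨div_pos h1 h0, (div_lt_one h0).2 h2⟩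
      · exact ⟨h0, h3⟩
    · funext i
      fin_cases i
      · have h0' := h0.ne'
        simp [soloInformedUpperMat, Fin.prod_univ_two]
        field_simp
      · simp [soloInformedUpperMat, Fin.prod_univ_two]

/-- The lower triangle lies in the open square. -/
theorem soloInformedLowerTri_subset_openCube : soloInformedLowerTri ⊆ soloInformedOpenCube 2 :=
  fun p hp j => by
    fin_cases j
    · exact ⟨hp.1.trans hp.2.1, hp.2.2⟩
    · exact ⟨hp.1, hp.2.1.trans hp.2.2⟩

/-- The upper triangle lies in the open square. -/
theorem soloInformedUpperTri_subset_openCube : soloInformedUpperTri ⊆ soloInformedOpenCube 2 :=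
  fun p hp j => by
    fin_cases j
    · exact ⟨hp.1, hp.2.1.trans hp.2.2⟩
    · exact ⟨hp.1.trans hp.2.1, hp.2.2⟩

/-- The lower triangle is `ℚ`-semialgebraic. [BCR 1998, §2.1] -/
theorem isSemialgebraic_soloInformedLowerTri : IsSemialgebraic ℚ soloInformedLowerTri := by
  have h1 : IsSemialgebraic ℚ {x : Fin 2 → ℝ | 0 < x 1} := by
    simpa using Literature.ModelTheory.ExponentialFields.isSemialgebraic_setOf_eval_lt (k := ℚ)
      (R := ℝ) (0 : MvPolynomial (Fin 2) ℚ) (MvPolynomial.X 1)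
  have h2 : IsSemialgebraic ℚ {x : Fin 2 → ℝ | x 1 < x 0} := by
    simpa using Literature.ModelTheory.ExponentialFields.isSemialgebraic_setOf_eval_lt (k := ℚ)
      (R := ℝ) (MvPolynomial.X 1 : MvPolynomial (Fin 2) ℚ) (MvPolynomial.X 0)
  have h3 : IsSemialgebraic ℚ {x : Fin 2 → ℝ | x 0 < 1} := by
    simpa using Literature.ModelTheory.ExponentialFields.isSemialgebraic_setOf_eval_lt (k := ℚ)
      (R := ℝ) (MvPolynomial.X 0 : MvPolynomial (Fin 2) ℚ) 1
  have hset : soloInformedLowerTri =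
      ({x : Fin 2 → ℝ | 0 < x 1} ∩ {x | x 1 < x 0}) ∩ {x | x 0 < 1} := by
    ext x; simp [soloInformedLowerTri, and_assoc]
  rw [hset]
  exact (h1.inter h2).inter h3

/-- The upper triangle is `ℚ`-semialgebraic. [BCR 1998, §2.1] -/
theorem isSemialgebraic_soloInformedUpperTri : IsSemialgebraic ℚ soloInformedUpperTri := by
  have h1 : IsSemialgebraic ℚ {x : Fin 2 → ℝ | 0 < x 0} := by
    simpa using Literature.ModelTheory.ExponentialFields.isSemialgebraic_setOf_eval_lt (k := ℚ)
      (R := ℝ) (0 : MvPolynomial (Fin 2) ℚ) (MvPolynomial.X 0)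
  have h2 : IsSemialgebraic ℚ {x : Fin 2 → ℝ | x 0 < x 1} := by
    simpa using Literature.ModelTheory.ExponentialFields.isSemialgebraic_setOf_eval_lt (k := ℚ)
      (R := ℝ) (MvPolynomial.X 0 : MvPolynomial (Fin 2) ℚ) (MvPolynomial.X 1)
  have h3 : IsSemialgebraic ℚ {x : Fin 2 → ℝ | x 1 < 1} := by
    simpa using Literature.ModelTheory.ExponentialFields.isSemialgebraic_setOf_eval_lt (k := ℚ)
      (R := ℝ) (MvPolynomial.X 1 : MvPolynomial (Fin 2) ℚ) 1
  have hset : soloInformedUpperTri =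
      ({x : Fin 2 → ℝ | 0 < x 0} ∩ {x | x 0 < x 1}) ∩ {x | x 1 < 1} := by
    ext x; simp [soloInformedUpperTri, and_assoc]
  rw [hset]
  exact (h1.inter h2).inter h3

/-- The two triangles are disjoint. -/
theorem soloInformedLowerTri_inter_upperTri :
    soloInformedLowerTri ∩ soloInformedUpperTri = ∅ :=
  Set.eq_empty_iff_forall_notMem.2 fun _ hp => lt_asymm hp.1.2.1 hp.2.2.1

/-- **The square is the two triangles up to a null set** (`∂[0,1]²` is null, and so is the
diagonal — a proper linear subspace; the latter is also the tree lemma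
`LiftingCriteria.DilationTransfer.volume_setOf_apply_zero_eq_apply_one`, whose module lies
outside this file's import closure). -/
theorem soloInformed_volume_cube_diff_tris :
    volume (soloInformedCube 2 \ (soloInformedLowerTri ∪ soloInformedUpperTri)) = 0 := by
  have hdiag : volume {p : Fin 2 → ℝ | p 0 = p 1} = 0 := by
    set L : (Fin 2 → ℝ) →ₗ[ℝ] ℝ := LinearMap.proj (R := ℝ) (φ := fun _ : Fin 2 => ℝ) 0 -
      LinearMap.proj (R := ℝ) (φ := fun _ : Fin 2 => ℝ) 1 with hL
    have hker : ({p : Fin 2 → ℝ | p 0 = p 1} : Set (Fin 2 → ℝ)) =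
        (LinearMap.ker L : Set (Fin 2 → ℝ)) := by
      ext p
      simp [hL, sub_eq_zero]
    have hne : LinearMap.ker L ≠ ⊤ := by
      intro h
      have hmem : (![(1 : ℝ), 0] : Fin 2 → ℝ) ∈ LinearMap.ker L := h ▸ Submodule.mem_top
      simp [hL] at hmem
    rw [hker]
    exact Measure.addHaar_submodule volume _ hne
  refine measure_mono_null (fun p hp => ?_)
    (measure_union_null (soloInformed_volume_cube_diff_openCube 2) hdiag)
  by_cases ho : p ∈ soloInformedOpenCube 2
  · refine Or.inr ?_
    have h0 := ho 0
    have h1 := ho 1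
    rcases lt_trichotomy (p 1) (p 0) with h | h | h
    · exact absurd (Or.inl ⟨h1.1, h, h0.2⟩) hp.2
    · exact h.symm
    · exact absurd (Or.inr ⟨h0.1, h, h1.2⟩) hp.2
  · exact Or.inl ⟨hp.1, ho⟩

/-! ## THEOREM DIAG -/

/-- **THEOREM DIAG (diagonal split of the square).**  Let `r = [σ, f]` with
`(0,1)² ⊆ σ ⊆ [0,1]²` and `f = P/Q` on the open square, and let `P₁/Q₁`, `P₂/Q₂` (`Qᵢ ≠ 0` on
`(0,1)²`) be the pulled-back forms `f(v₀, v₀v₁) v₀` and `f(u₀u₁, u₁) u₁` along the two triangle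
charts.  If every `IntegralRep` on `(0,1)²` with integrand `Pᵢ/Qᵢ` is presentable (`i = 1, 2`),
then `of r` is presentable: split `σ` along the diagonal (null, rule (1a)) and apply rule (2)
along the two monomial charts. [this work] -/
theorem soloInformed_presentable_of_diagonalCharts (P Q P₁ Q₁ P₂ Q₂ : MvPolynomial (Fin 2) ℚ)
    (hQ₁ : ∀ v ∈ soloInformedOpenCube 2, MvPolynomial.aeval v Q₁ ≠ 0)
    (hQ₂ : ∀ v ∈ soloInformedOpenCube 2, MvPolynomial.aeval v Q₂ ≠ 0)
    (h₁ : ∀ v ∈ soloInformedOpenCube 2,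
      MvPolynomial.aeval (fun i => ∏ j, v j ^ soloInformedLowerMat i j) P /
          MvPolynomial.aeval (fun i => ∏ j, v j ^ soloInformedLowerMat i j) Q * v 0 =
        MvPolynomial.aeval v P₁ / MvPolynomial.aeval v Q₁)
    (h₂ : ∀ v ∈ soloInformedOpenCube 2,
      MvPolynomial.aeval (fun i => ∏ j, v j ^ soloInformedUpperMat i j) P /
          MvPolynomial.aeval (fun i => ∏ j, v j ^ soloInformedUpperMat i j) Q * v 1 =
        MvPolynomial.aeval v P₂ / MvPolynomial.aeval v Q₂)
    (hp₁ : ∀ ρ : IntegralRep 2, ρ.domain = soloInformedOpenCube 2 →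
      EqOn ρ.integrand (fun v => MvPolynomial.aeval v P₁ / MvPolynomial.aeval v Q₁)
        (soloInformedOpenCube 2) → of ρ ∈ soloInformedPresentable)
    (hp₂ : ∀ ρ : IntegralRep 2, ρ.domain = soloInformedOpenCube 2 →
      EqOn ρ.integrand (fun v => MvPolynomial.aeval v P₂ / MvPolynomial.aeval v Q₂)
        (soloInformedOpenCube 2) → of ρ ∈ soloInformedPresentable)
    (r : IntegralRep 2) (hO : soloInformedOpenCube 2 ⊆ r.domain)
    (hC : r.domain ⊆ soloInformedCube 2)
    (hri : EqOn r.integrand (fun x => MvPolynomial.aeval x P / MvPolynomial.aeval x Q)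
      (soloInformedOpenCube 2)) :
    of r ∈ soloInformedPresentable := by
  have hT₁ : soloInformedLowerTri ⊆ r.domain := soloInformedLowerTri_subset_openCube.trans hO
  have hT₂ : soloInformedUpperTri ⊆ r.domain := soloInformedUpperTri_subset_openCube.trans hO
  refine soloInformed_presentable_of_cover r isSemialgebraic_soloInformedLowerTri
    isSemialgebraic_soloInformedUpperTri hT₁ hT₂
    (by rw [soloInformedLowerTri_inter_upperTri]; exact measure_empty)
    (measure_mono_null (show r.domain \ (soloInformedLowerTri ∪ soloInformedUpperTri) ⊆
        soloInformedCube 2 \ (soloInformedLowerTri ∪ soloInformedUpperTri) from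
      fun _ hp => ⟨hC hp.1, hp.2⟩) soloInformed_volume_cube_diff_tris) ?_ ?_
  · refine soloInformed_presentable_of_monoChart soloInformedLowerMat
      (by rw [soloInformed_det_lowerMat]; exact one_ne_zero) P₁ Q₁ hQ₁ _
      (by rw [IntegralRep.domain_restrict, soloInformed_image_lowerChart]) (fun v hv => ?_) hp₁
    have hmem : (fun i => ∏ j, v j ^ soloInformedLowerMat i j) ∈ soloInformedOpenCube 2 :=
      soloInformedLowerTri_subset_openCube (soloInformed_image_lowerChart ▸ mem_image_of_mem _ hv)
    rw [IntegralRep.integrand_restrict, hri hmem,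
      soloInformed_abs_det_monoD_lowerMat fun j => (hv j).1]
    exact h₁ v hv
  · refine soloInformed_presentable_of_monoChart soloInformedUpperMat
      (by rw [soloInformed_det_upperMat]; exact one_ne_zero) P₂ Q₂ hQ₂ _
      (by rw [IntegralRep.domain_restrict, soloInformed_image_upperChart]) (fun v hv => ?_) hp₂
    have hmem : (fun i => ∏ j, v j ^ soloInformedUpperMat i j) ∈ soloInformedOpenCube 2 :=
      soloInformedUpperTri_subset_openCube (soloInformed_image_upperChart ▸ mem_image_of_mem _ hv)
    rw [IntegralRep.integrand_restrict, hri hmem,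
      soloInformed_abs_det_monoD_upperMat fun j => (hv j).1]
    exact h₂ v hv

/-- **THEOREM DIAG + VERTEX.**  `[σ, P/Q]` (`(0,1)² ⊆ σ ⊆ [0,1]²`) is presentable as soon as
the two pulled-back forms along the triangle charts are `Pᵢ/Qᵢ` with SOME vertex reflection of
each `Qᵢ` cube-nondegenerate. [this work] -/
theorem soloInformed_presentable_of_diagonalCharts_vertex
    (P Q P₁ Q₁ P₂ Q₂ : MvPolynomial (Fin 2) ℚ) (S₁ S₂ : Finset (Fin 2))
    (hND₁ : SoloInformedCubeNondegenerate (soloInformedVertexReflect S₁ Q₁))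
    (hND₂ : SoloInformedCubeNondegenerate (soloInformedVertexReflect S₂ Q₂))
    (h₁ : ∀ v ∈ soloInformedOpenCube 2,
      MvPolynomial.aeval (fun i => ∏ j, v j ^ soloInformedLowerMat i j) P /
          MvPolynomial.aeval (fun i => ∏ j, v j ^ soloInformedLowerMat i j) Q * v 0 =
        MvPolynomial.aeval v P₁ / MvPolynomial.aeval v Q₁)
    (h₂ : ∀ v ∈ soloInformedOpenCube 2,
      MvPolynomial.aeval (fun i => ∏ j, v j ^ soloInformedUpperMat i j) P /
          MvPolynomial.aeval (fun i => ∏ j, v j ^ soloInformedUpperMat i j) Q * v 1 =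
        MvPolynomial.aeval v P₂ / MvPolynomial.aeval v Q₂)
    (r : IntegralRep 2) (hO : soloInformedOpenCube 2 ⊆ r.domain)
    (hC : r.domain ⊆ soloInformedCube 2)
    (hri : EqOn r.integrand (fun x => MvPolynomial.aeval x P / MvPolynomial.aeval x Q)
      (soloInformedOpenCube 2)) :
    of r ∈ soloInformedPresentable :=
  soloInformed_presentable_of_diagonalCharts P Q P₁ Q₁ P₂ Q₂
    (fun _ hv => soloInformed_aeval_ne_zero_of_vertexReflect_nondegenerate S₁ hND₁ hv)
    (fun _ hv => soloInformed_aeval_ne_zero_of_vertexReflect_nondegenerate S₂ hND₂ hv) h₁ h₂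
    (fun ρ hρ hρi =>
      soloInformed_presentable_of_vertexReflect_nondegenerate_open S₁ P₁ Q₁ hND₁ ρ hρ hρi)
    (fun ρ hρ hρi =>
      soloInformed_presentable_of_vertexReflect_nondegenerate_open S₂ P₂ Q₂ hND₂ ρ hρ hρi)
    r hO hC hri

end Summit.KontsevichZagierPeriods.KontsevichZagierPeriods.Theorems
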